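import Summits.AnomalousDissipation.AnomalousDissipation.Statement
import Literature.Dynamics.Ergodic.BirkhoffErgodicTheoremProofs
import Literature.Analysis.FluidPDE.LerayHopfSpectralMeasurability
import Literature.Analysis.FluidPDE.LerayHopfGeneralizedEnergyIneq

/-!
# Solo (blind) — ergodic realisation: `ZerothLaw` from stationary ensembles of Leray–Hopf paths

`Literature.Turb.ZerothLaw` asks for ONE Leray–Hopf trajectory per viscosity whose long-time
Cesàro means obey an energy bound and a dissipation floor. The turbulence literature states the
zeroth law for ENSEMBLE averages `⟨ε⟩ = ∫ ν‖∇u‖² dμ_ν` over a stationary statistical state. This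
file proves the passage ensemble → trajectory inside the kernel, with Birkhoff's pointwise ergodic
theorem (tree: `Literature.Dynamics.Ergodic.ae_tendsto_birkhoffAverage_condExp`) as the engine.

A *stationary ensemble of Leray–Hopf paths* of `NS_ν(f)` is a probability space `(Ω, μ)` with a
measure-preserving map `S` and a path map `Φ : Ω → (ℝ → 𝕋³ → ℝ³)` such that every `Φ ω` is a
global Leray–Hopf solution from its own value at `t = 0` and `Φ (S ω) = Φ ω (· + 1)` (time-one
shift) — i.e. a shift-invariant measure on trajectory space (a stationary "trajectory statistical
solution"), presented through a parametrisation so that no σ-algebra on path space is needed.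

* `timeMean_tendsto_of_natCesaro` (deterministic): for a nonnegative locally integrable `g` on
  `[0, ∞)`, convergence of the integer Cesàro means `n⁻¹∫₀ⁿ g → L` gives `timeMean g T → L`.
* `birkhoffSum_unitWindow_eq_intervalIntegral`: along a stationary path functional the Birkhoff sums
  of the unit-window integral `∫₀¹ g` ARE the time integrals `∫₀ⁿ g`.
* `ae_timeMean_tendsto_condExp_invariants`: hence, for `μ`-a.e. `ω`, `timeMean (g ω) T` converges
  (to the
  conditional expectation of the window functional on the invariant σ-algebra; to its mean if
  `S` is ergodic: `ae_timeMean_tendsto_integral_of_ergodic`).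
* `exists_witnessPath_of_stationaryEnsemble`: if the unit-window energy is `≤ E` for a.e. path and
  the ensemble
  mean of the unit-window viscous dissipation is `≥ ε`, some path has `meanEnergy ≤ E` and
  `meanDissipation ≥ ε` (as LIMITS); `ae_witnessPath_of_ergodicEnsemble`: for an ERGODIC ensemble
  with
  mean window energy `≤ E` and mean window dissipation `≥ ε`, almost every path does.
* `zerothLaw_of_stationaryLHEnsembles` / `zerothLaw_of_ergodicLHEnsembles`: the doors — `ZerothLaw`
  follows BY NAME from such ensembles along `ν_j → 0` for one admissible force.

So the trajectory-wise summit statement is implied by its statistical form: no datum and no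
trajectory need be selected, only a stationary ensemble with an O(1) mean dissipation. (The
converse passage trajectory → stationary statistical solution, by generalized limits of time
averages, is the classical Krylov–Bogoliubov construction of Foias–Manley–Rosa–Temam, Ch. IV §3.)
[folklore] [cite: DajaniKalle2021, Thm 3.1.1] [cite: FoiasManleyRosaTemam2001, Ch. IV §3,
Def. 3.1, Prop. 3.1, Thm. 3.1] [cite: Frisch1995, §6.1]
-/

open MeasureTheory Filter Topology Set
open scoped ENNReal NNReal

noncomputable section

namespace Summit.AnomalousDissipation.AnomalousDissipation.Theorems

open Literature.Analysis.FunctionSpaces Literature.Analysis.FunctionSpaces.Torus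
open Literature.Analysis.FluidPDE

/-! ### Deterministic: integer Cesàro means control the running means -/

/-- For `g ≥ 0` locally integrable on `[0, ∞)`, if `n⁻¹ ∫₀ⁿ g → L` along the integers then the
running means `T⁻¹ ∫₀ᵀ g` converge to `L` as `T → ∞` (sandwich between consecutive integers).
[folklore] -/
theorem timeMean_tendsto_of_natCesaro {g : ℝ → ℝ} (hg : ∀ t, 0 ≤ t → 0 ≤ g t)
    (hint : ∀ a b : ℝ, 0 ≤ a → a ≤ b → IntervalIntegrable g volume a b) {L : ℝ}
    (hlim : Tendsto (fun n : ℕ => (n : ℝ)⁻¹ * ∫ t in (0 : ℝ)..n, g t) atTop (𝓝 L)) :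
    Tendsto (timeMean g) atTop (𝓝 L) := by
  set F : ℝ → ℝ := fun T => ∫ t in (0 : ℝ)..T, g t with hF
  -- monotonicity of `F` on `[0, ∞)`
  have hFmono : ∀ a b : ℝ, 0 ≤ a → a ≤ b → F a ≤ F b := by
    intro a b ha hab
    have hadd :=
      intervalIntegral.integral_add_adjacent_intervals (hint 0 a le_rfl ha) (hint a b ha hab)
    have hnn : 0 ≤ ∫ t in a..b, g t :=
      intervalIntegral.integral_nonneg hab fun t ht => hg t (ha.trans ht.1)
    simp only [hF]
    linarith
  have hF0 : ∀ b : ℝ, 0 ≤ b → 0 ≤ F b := by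
    intro b hb
    have := hFmono 0 b le_rfl hb
    simpa [hF] using this
  -- the two comparison sequences
  set a : ℕ → ℝ := fun n => (n : ℝ)⁻¹ * F n with ha
  have ha1 : Tendsto (fun n : ℕ => a (n + 1)) atTop (𝓝 L) := hlim.comp (tendsto_add_atTop_nat 1)
  have hlo : Tendsto (fun n : ℕ => ((n : ℝ) / ((n : ℝ) + 1)) * a n) atTop (𝓝 L) := by
    have h1 : Tendsto (fun n : ℕ => (n : ℝ) / ((n : ℝ) + 1)) atTop (𝓝 1) :=
      tendsto_natCast_div_add_atTop (1 : ℝ)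
    simpa using h1.mul hlim
  have hhi : Tendsto (fun n : ℕ => (1 + (n : ℝ)⁻¹) * a (n + 1)) atTop (𝓝 L) := by
    have h1 : Tendsto (fun n : ℕ => (1 + (n : ℝ)⁻¹)) atTop (𝓝 1) := by
      simpa using (tendsto_const_nhds (x := (1 : ℝ))).add (tendsto_inv_atTop_nhds_zero_nat (𝕜 := ℝ))
    simpa using h1.mul ha1
  have hfl : Tendsto (fun T : ℝ => ⌊T⌋₊) atTop atTop := tendsto_nat_floor_atTop
  refine tendsto_of_tendsto_of_tendsto_of_le_of_le' (hlo.comp hfl) (hhi.comp hfl) ?_ ?_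
  · filter_upwards [eventually_ge_atTop (1 : ℝ)] with T hT
    have hT0 : 0 ≤ T := zero_le_one.trans hT
    have hn1 : (1 : ℕ) ≤ ⌊T⌋₊ := Nat.le_floor (by simpa using hT)
    set n : ℕ := ⌊T⌋₊ with hn
    have hnT : (n : ℝ) ≤ T := Nat.floor_le hT0
    have hTn : T < (n : ℝ) + 1 := Nat.lt_floor_add_one T
    have hnpos : (0 : ℝ) < n := by exact_mod_cast hn1
    have hTpos : 0 < T := lt_of_lt_of_le zero_lt_one hT
    -- lower bound: (n/(n+1)) a_n = F n/(n+1) ≤ F n / T ≤ F T / T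
    simp only [Function.comp_apply, timeMean]
    have h1 : (n : ℝ) / ((n : ℝ) + 1) * a n = F n / ((n : ℝ) + 1) := by
      simp only [ha]; field_simp
    rw [h1]
    calc F n / ((n : ℝ) + 1) ≤ F n / T := by
          apply div_le_div_of_nonneg_left (hF0 n (Nat.cast_nonneg n)) hTpos hTn.le
      _ = T⁻¹ * F n := by rw [div_eq_inv_mul]
      _ ≤ T⁻¹ * F T :=
          mul_le_mul_of_nonneg_left (hFmono n T (Nat.cast_nonneg n) hnT) (inv_nonneg.mpr hT0)
  · filter_upwards [eventually_ge_atTop (1 : ℝ)] with T hT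
    have hT0 : 0 ≤ T := zero_le_one.trans hT
    have hn1 : (1 : ℕ) ≤ ⌊T⌋₊ := Nat.le_floor (by simpa using hT)
    set n : ℕ := ⌊T⌋₊ with hn
    have hnT : (n : ℝ) ≤ T := Nat.floor_le hT0
    have hTn : T < (n : ℝ) + 1 := Nat.lt_floor_add_one T
    have hnpos : (0 : ℝ) < n := by exact_mod_cast hn1
    have hTpos : 0 < T := lt_of_lt_of_le zero_lt_one hT
    simp only [Function.comp_apply, timeMean]
    have h1 : (1 + (n : ℝ)⁻¹) * a (n + 1) = F ((n : ℝ) + 1) / n := by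
      simp only [ha, Nat.cast_add, Nat.cast_one]; field_simp
    rw [h1]
    calc T⁻¹ * F T ≤ T⁻¹ * F ((n : ℝ) + 1) :=
          mul_le_mul_of_nonneg_left (hFmono T ((n : ℝ) + 1) hT0 hTn.le) (inv_nonneg.mpr hT0)
      _ = F ((n : ℝ) + 1) / T := by rw [div_eq_inv_mul]
      _ ≤ F ((n : ℝ) + 1) / n :=
          div_le_div_of_nonneg_left (hF0 _ (by positivity)) hnpos hnT

/-! ### Stationary path functionals: Birkhoff sums are time integrals -/

section Ensemble

variable {Ω : Type*} {S : Ω → Ω} {g : Ω → ℝ → ℝ}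

/-- Iterating the time-one shift: `g (S^[k] ω) t = g ω (t + k)`. [folklore] -/
theorem pathShift_iterate_apply (hshift : ∀ ω t, g (S ω) t = g ω (t + 1)) (k : ℕ) (ω : Ω) (t : ℝ) :
    g (S^[k] ω) t = g ω (t + k) := by
  induction k generalizing ω t with
  | zero => simp
  | succ k ih =>
    rw [Function.iterate_succ_apply, ih (S ω) t, hshift ω, Nat.cast_add, Nat.cast_one, add_assoc]

/-- Along a stationary path functional (`g (S ω) = g ω (· + 1)`, locally integrable on
`[0, ∞)`), the Birkhoff sum of the unit-window integral `ω ↦ ∫₀¹ g ω` over `n` steps is the time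
integral `∫₀ⁿ g ω`. [folklore] -/
theorem birkhoffSum_unitWindow_eq_intervalIntegral (hshift : ∀ ω t, g (S ω) t = g ω (t + 1))
    (hint : ∀ ω (a b : ℝ), 0 ≤ a → a ≤ b → IntervalIntegrable (g ω) volume a b) (n : ℕ) (ω : Ω) :
    birkhoffSum S (fun ω' => ∫ t in (0 : ℝ)..1, g ω' t) n ω = ∫ t in (0 : ℝ)..n, g ω t := by
  simp only [birkhoffSum]
  have hk : ∀ k : ℕ,
      (∫ t in (0 : ℝ)..1, g (S^[k] ω) t) = ∫ t in (k : ℝ)..((k + 1 : ℕ) : ℝ), g ω t := by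
    intro k
    have h1 : (fun t => g (S^[k] ω) t) = fun t => g ω (t + k) := by
      funext t; exact pathShift_iterate_apply hshift k ω t
    rw [h1, intervalIntegral.integral_comp_add_right (fun t => g ω t) (k : ℝ)]
    simp [add_comm]
  simp_rw [hk]
  have hadj := intervalIntegral.sum_integral_adjacent_intervals (f := g ω) (μ := volume)
    (a := fun k : ℕ => (k : ℝ)) (n := n) (fun k _ => hint ω k ((k + 1 : ℕ) : ℝ) (Nat.cast_nonneg k)
      (by exact_mod_cast (Nat.le_succ k)))
  simpa using hadj

variable [MeasurableSpace Ω] {μ : Measure Ω}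

/-- **Time means converge along almost every path of a stationary ensemble.** If `S` preserves
the probability measure `μ`, `g` is a nonnegative stationary path functional, locally integrable
on `[0, ∞)` along every path, with integrable unit-window integral `G ω = ∫₀¹ g ω`, and the
Birkhoff averages of `G` converge a.e. to `Λ ω`, then `timeMean (g ω) T → Λ ω` for a.e. `ω`.
[folklore] -/
theorem ae_timeMean_tendsto_of_birkhoffAverage (hshift : ∀ ω t, g (S ω) t = g ω (t + 1))
    (hnonneg : ∀ ω t, 0 ≤ t → 0 ≤ g ω t)
    (hint : ∀ ω (a b : ℝ), 0 ≤ a → a ≤ b → IntervalIntegrable (g ω) volume a b) {Λ : Ω → ℝ}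
    (hB : ∀ᵐ ω ∂μ,
      Tendsto (fun n : ℕ => birkhoffAverage ℝ S (fun ω' => ∫ t in (0 : ℝ)..1, g ω' t) n ω) atTop
        (𝓝 (Λ ω))) :
    ∀ᵐ ω ∂μ, Tendsto (timeMean (g ω)) atTop (𝓝 (Λ ω)) := by
  filter_upwards [hB] with ω hω
  refine timeMean_tendsto_of_natCesaro (hnonneg ω) (hint ω) ?_
  have heq : (fun n : ℕ => (n : ℝ)⁻¹ * ∫ t in (0 : ℝ)..n, g ω t) =
      fun n : ℕ => birkhoffAverage ℝ S (fun ω' => ∫ t in (0 : ℝ)..1, g ω' t) n ω := by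
    funext n
    rw [birkhoffAverage, birkhoffSum_unitWindow_eq_intervalIntegral hshift hint n ω, smul_eq_mul]
  rw [heq]
  exact hω

/-- Conditional-expectation form: for a measure-preserving `S` on a probability space the time
means of a nonnegative stationary path functional converge a.e. to `E[∫₀¹ g | 𝓘]`, `𝓘` the
invariant σ-algebra of `S` (Birkhoff, tree `ae_tendsto_birkhoffAverage_condExp`).
[cite: DajaniKalle2021, Thm 3.1.1] -/
theorem ae_timeMean_tendsto_condExp_invariants [IsProbabilityMeasure μ]
    (hS : MeasurePreserving S μ μ)
    (hshift : ∀ ω t, g (S ω) t = g ω (t + 1)) (hnonneg : ∀ ω t, 0 ≤ t → 0 ≤ g ω t)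
    (hint : ∀ ω (a b : ℝ), 0 ≤ a → a ≤ b → IntervalIntegrable (g ω) volume a b)
    (hG : Integrable (fun ω => ∫ t in (0 : ℝ)..1, g ω t) μ) :
    ∀ᵐ ω ∂μ, Tendsto (timeMean (g ω)) atTop
      (𝓝 ((μ[(fun ω' => ∫ t in (0 : ℝ)..1, g ω' t)|MeasurableSpace.invariants S]) ω)) :=
  ae_timeMean_tendsto_of_birkhoffAverage hshift hnonneg hint
    (Literature.Dynamics.Ergodic.ae_tendsto_birkhoffAverage_condExp hS hG)

/-- Ergodic form: if moreover `S` is ergodic, the time means converge a.e. to the ensemble mean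
`∫ (∫₀¹ g) dμ` (tree `birkhoff_ergodic_theorem_of_ergodic_holds`).
[cite: DajaniKalle2021, Thm 3.1.1] -/
theorem ae_timeMean_tendsto_integral_of_ergodic [IsProbabilityMeasure μ] (hS : Ergodic S μ)
    (hshift : ∀ ω t, g (S ω) t = g ω (t + 1)) (hnonneg : ∀ ω t, 0 ≤ t → 0 ≤ g ω t)
    (hint : ∀ ω (a b : ℝ), 0 ≤ a → a ≤ b → IntervalIntegrable (g ω) volume a b)
    (hG : Integrable (fun ω => ∫ t in (0 : ℝ)..1, g ω t) μ) :
    ∀ᵐ ω ∂μ, Tendsto (timeMean (g ω)) atTop (𝓝 (∫ ω', (∫ t in (0 : ℝ)..1, g ω' t) ∂μ)) :=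
  ae_timeMean_tendsto_of_birkhoffAverage hshift hnonneg hint
    (Literature.Dynamics.Ergodic.birkhoff_ergodic_theorem_of_ergodic_holds μ S hS _ hG)

end Ensemble

/-! ### Leray–Hopf paths: the energy and dissipation functionals -/

section Paths

variable {ν : ℝ} {f u₀ : UnitAddTorus (Fin 3) → EuclideanSpace ℝ (Fin 3)}
  {u : ℝ → UnitAddTorus (Fin 3) → EuclideanSpace ℝ (Fin 3)}

/-- Along a global Leray–Hopf path the energy slice `t ↦ ‖u(t)‖₂²` is integrable on every
`[a, b] ⊂ [0, ∞)`. [folklore] -/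
theorem lhPath_intervalIntegrable_energy (hu : Torus.IsGlobalLerayHopf ν (fun _ => f) u₀ u)
    {a b : ℝ} (ha : 0 ≤ a) (hab : a ≤ b) :
    IntervalIntegrable (fun t => ∫ x, ‖u t x‖ ^ 2) volume a b := by
  rw [intervalIntegrable_iff_integrableOn_Ioc_of_le hab]
  have h := (hu (b + 1) (by linarith)).integrableOn_integral_norm_sq
  exact h.mono_set fun t ht => ⟨ha.trans_lt ht.1, by linarith [ht.2]⟩

/-- Along a global Leray–Hopf path the viscous dissipation slice `t ↦ ν‖∇u(t)‖₂²` (spectral,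
`toReal`) is integrable on every `[a, b] ⊂ [0, ∞)`. [folklore] -/
theorem lhPath_intervalIntegrable_dissipation (hu : Torus.IsGlobalLerayHopf ν (fun _ => f) u₀ u)
    {a b : ℝ} (ha : 0 ≤ a) (hab : a ≤ b) :
    IntervalIntegrable (fun t => ν * (eGradNormSq (u t)).toReal) volume a b := by
  rw [intervalIntegrable_iff_integrableOn_Ioc_of_le hab]
  exact ((hu.setIntegral_toReal_eGradNormSq (s := a) (t := b) ha).1).const_mul ν

end Paths

/-! ### The realisation theorems -/

section Realisation

variable {Ω : Type*} [MeasurableSpace Ω] {μ : Measure Ω} [IsProbabilityMeasure μ] {S : Ω → Ω}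
  {ν E ε : ℝ} {f : UnitAddTorus (Fin 3) → EuclideanSpace ℝ (Fin 3)}
  {Φ : Ω → ℝ → UnitAddTorus (Fin 3) → EuclideanSpace ℝ (Fin 3)}

/-- **Ergodic realisation (bounded windows).** A stationary ensemble of global Leray–Hopf paths
of `NS_ν(f)`, `ν ≥ 0`, whose unit-window energy `∫₀¹‖u‖₂²` is `≤ E` along a.e. path and whose
ensemble-mean unit-window viscous dissipation `∫(∫₀¹ ν‖∇u‖₂²)dμ` is `≥ ε`, contains a path with
`meanEnergy ≤ E` and `ε ≤ meanDissipation` — both long-time means being genuine limits along it.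
Engine: Birkhoff (conditional-expectation form) for the two window functionals, `E[e|𝓘] ≤ E`
a.e., and `∫ E[d|𝓘] = ∫ d ≥ ε` forces `E[d|𝓘] ≥ ε` on a non-null set. [folklore] -/
theorem exists_witnessPath_of_stationaryEnsemble (hS : MeasurePreserving S μ μ) (hν : 0 ≤ ν)
    (hLH : ∀ ω, Torus.IsGlobalLerayHopf ν (fun _ => f) (Φ ω 0) (Φ ω))
    (hshift : ∀ ω t, Φ (S ω) t = Φ ω (t + 1))
    (hEint : Integrable (fun ω => ∫ t in (0 : ℝ)..1, ∫ x, ‖Φ ω t x‖ ^ 2) μ)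
    (hEle : ∀ᵐ ω ∂μ, (∫ t in (0 : ℝ)..1, ∫ x, ‖Φ ω t x‖ ^ 2) ≤ E)
    (hDint : Integrable (fun ω => ∫ t in (0 : ℝ)..1, ν * (eGradNormSq (Φ ω t)).toReal) μ)
    (hDge : ε ≤ ∫ ω, (∫ t in (0 : ℝ)..1, ν * (eGradNormSq (Φ ω t)).toReal) ∂μ) :
    ∃ ω, meanEnergy (Φ ω) ≤ E ∧ ε ≤ meanDissipation ν (Φ ω) := by
  set eW : Ω → ℝ := fun ω => ∫ t in (0 : ℝ)..1, ∫ x, ‖Φ ω t x‖ ^ 2 with heW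
  set dW : Ω → ℝ := fun ω => ∫ t in (0 : ℝ)..1, ν * (eGradNormSq (Φ ω t)).toReal with hdW
  have hI := MeasurableSpace.invariants_le S
  -- a.e. convergence of the running means of energy and dissipation
  have hconvE : ∀ᵐ ω ∂μ, Tendsto (timeMean fun t => ∫ x, ‖Φ ω t x‖ ^ 2) atTop
      (𝓝 ((μ[eW|MeasurableSpace.invariants S]) ω)) :=
    ae_timeMean_tendsto_condExp_invariants (g := fun ω t => ∫ x, ‖Φ ω t x‖ ^ 2) hS
      (fun ω t => by simp [hshift ω t]) (fun ω t _ => integral_nonneg fun x => sq_nonneg _)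
      (fun ω a b ha hab => lhPath_intervalIntegrable_energy (hLH ω) ha hab) hEint
  have hconvD : ∀ᵐ ω ∂μ, Tendsto (timeMean fun t => ν * (eGradNormSq (Φ ω t)).toReal) atTop
      (𝓝 ((μ[dW|MeasurableSpace.invariants S]) ω)) :=
    ae_timeMean_tendsto_condExp_invariants (g := fun ω t => ν * (eGradNormSq (Φ ω t)).toReal) hS
      (fun ω t => by simp [hshift ω t]) (fun ω t _ => mul_nonneg hν ENNReal.toReal_nonneg)
      (fun ω a b ha hab => lhPath_intervalIntegrable_dissipation (hLH ω) ha hab) hDint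
  -- the conditional energy is `≤ E` a.e.
  have hEstar : ∀ᵐ ω ∂μ, (μ[eW|MeasurableSpace.invariants S]) ω ≤ E := by
    have h1 : μ[eW|MeasurableSpace.invariants S] ≤ᵐ[μ]
        μ[(fun _ : Ω => E)|MeasurableSpace.invariants S] :=
      condExp_mono hEint (integrable_const E) hEle
    rw [condExp_const hI E] at h1
    exact h1
  -- the conditional dissipation is `≥ ε` on a non-null set
  have hDstar : ∃ᵐ ω ∂μ, ε ≤ (μ[dW|MeasurableSpace.invariants S]) ω := by
    by_contra hcon
    rw [Filter.not_frequently] at hcon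
    have hlt : ∀ᵐ ω ∂μ, (μ[dW|MeasurableSpace.invariants S]) ω < ε :=
      hcon.mono fun ω h => not_le.mp h
    have hle : μ[dW|MeasurableSpace.invariants S] ≤ᵐ[μ] fun _ => ε := hlt.mono fun ω h => h.le
    have hIc : ∫ ω, (fun _ : Ω => ε) ω ∂μ = ε := by simp
    have h1 : ∫ ω, (μ[dW|MeasurableSpace.invariants S]) ω ∂μ ≤ ∫ ω, (fun _ : Ω => ε) ω ∂μ :=
      integral_mono_ae integrable_condExp (integrable_const ε) hle
    have h2 : ∫ ω, (fun _ : Ω => ε) ω ∂μ ≤ ∫ ω, (μ[dW|MeasurableSpace.invariants S]) ω ∂μ := by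
      rw [hIc, integral_condExp hI]; exact hDge
    have heq := (integral_eq_iff_of_ae_le integrable_condExp (integrable_const ε) hle).1
      (le_antisymm h1 h2)
    obtain ⟨ω, hω1, hω2⟩ := (hlt.and heq).exists
    exact absurd hω2 (ne_of_lt hω1)
  obtain ⟨ω, ⟨hω1, hω2, hω3⟩, hω4⟩ :=
    ((hconvE.and (hEstar.and hconvD)).and_frequently hDstar).exists
  refine ⟨ω, ?_, ?_⟩
  · change limsup (timeMean fun t => ∫ x, ‖Φ ω t x‖ ^ 2) atTop ≤ E
    rw [hω1.limsup_eq]; exact hω2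
  · change ε ≤ limsup (timeMean fun t => ν * (eGradNormSq (Φ ω t)).toReal) atTop
    rw [hω3.limsup_eq]; exact hω4

/-- **Ergodic realisation (ergodic ensembles).** If the stationary ensemble is ERGODIC, with mean
unit-window energy `≤ E` and mean unit-window viscous dissipation `≥ ε`, then ALMOST EVERY path has
`meanEnergy ≤ E` and `ε ≤ meanDissipation` (time means = ensemble means). [folklore] -/
theorem ae_witnessPath_of_ergodicEnsemble (hS : Ergodic S μ) (hν : 0 ≤ ν)
    (hLH : ∀ ω, Torus.IsGlobalLerayHopf ν (fun _ => f) (Φ ω 0) (Φ ω))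
    (hshift : ∀ ω t, Φ (S ω) t = Φ ω (t + 1))
    (hEint : Integrable (fun ω => ∫ t in (0 : ℝ)..1, ∫ x, ‖Φ ω t x‖ ^ 2) μ)
    (hEle : ∫ ω, (∫ t in (0 : ℝ)..1, ∫ x, ‖Φ ω t x‖ ^ 2) ∂μ ≤ E)
    (hDint : Integrable (fun ω => ∫ t in (0 : ℝ)..1, ν * (eGradNormSq (Φ ω t)).toReal) μ)
    (hDge : ε ≤ ∫ ω, (∫ t in (0 : ℝ)..1, ν * (eGradNormSq (Φ ω t)).toReal) ∂μ) :
    ∀ᵐ ω ∂μ, meanEnergy (Φ ω) ≤ E ∧ ε ≤ meanDissipation ν (Φ ω) := by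
  have hconvE := ae_timeMean_tendsto_integral_of_ergodic (g := fun ω t => ∫ x, ‖Φ ω t x‖ ^ 2) hS
    (fun ω t => by simp [hshift ω t]) (fun ω t _ => integral_nonneg fun x => sq_nonneg _)
    (fun ω a b ha hab => lhPath_intervalIntegrable_energy (hLH ω) ha hab) hEint
  have hconvD := ae_timeMean_tendsto_integral_of_ergodic
    (g := fun ω t => ν * (eGradNormSq (Φ ω t)).toReal) hS
    (fun ω t => by simp [hshift ω t]) (fun ω t _ => mul_nonneg hν ENNReal.toReal_nonneg)
    (fun ω a b ha hab => lhPath_intervalIntegrable_dissipation (hLH ω) ha hab) hDint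
  filter_upwards [hconvE, hconvD] with ω hω1 hω2
  refine ⟨?_, ?_⟩
  · change limsup (timeMean fun t => ∫ x, ‖Φ ω t x‖ ^ 2) atTop ≤ E
    rw [hω1.limsup_eq]; exact hEle
  · change ε ≤ limsup (timeMean fun t => ν * (eGradNormSq (Φ ω t)).toReal) atTop
    rw [hω2.limsup_eq]; exact hDge

end Realisation

/-! ### The doors -/

/-- **Door: `ZerothLaw` from stationary ensembles (statistical zeroth law ⇒ zeroth law).** Fix one
admissible force, `ν_j → 0⁺`, `ε > 0`, `E`. If for every `j` there is a stationary ensemble of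
Leray–Hopf paths of `NS_{ν_j}(f)` — a probability space `(Ω, μ)`, a measure-preserving `S` and a
path map `Φ` with `Φ (S ω) = Φ ω (· + 1)` — whose unit-window energy is `≤ E` along a.e. path and
whose ensemble-mean unit-window viscous dissipation is `≥ ε`, then `ZerothLaw` holds: each ensemble
contains a witness path (`exists_witnessPath_of_stationaryEnsemble`), taken with its own value at
`t = 0` as datum.
[folklore] -/
theorem zerothLaw_of_stationaryLHEnsembles {f : UnitAddTorus (Fin 3) → EuclideanSpace ℝ (Fin 3)}
    (hf : IsSmooth f) (hfdiv : IsDivFree f) (hf0 : HasZeroMean f) {ν : ℕ → ℝ} (hν : ∀ j, 0 < ν j)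
    (hν0 : Tendsto ν atTop (𝓝 0)) {E ε : ℝ} (hε : 0 < ε)
    (hens : ∀ j, ∃ (Ω : Type) (_ : MeasurableSpace Ω) (μ : Measure Ω) (_ : IsProbabilityMeasure μ)
      (S : Ω → Ω) (Φ : Ω → ℝ → UnitAddTorus (Fin 3) → EuclideanSpace ℝ (Fin 3)),
      MeasurePreserving S μ μ ∧ (∀ ω, Torus.IsGlobalLerayHopf (ν j) (fun _ => f) (Φ ω 0) (Φ ω)) ∧
        (∀ ω t, Φ (S ω) t = Φ ω (t + 1)) ∧
        Integrable (fun ω => ∫ t in (0 : ℝ)..1, ∫ x, ‖Φ ω t x‖ ^ 2) μ ∧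
        (∀ᵐ ω ∂μ, (∫ t in (0 : ℝ)..1, ∫ x, ‖Φ ω t x‖ ^ 2) ≤ E) ∧
        Integrable (fun ω => ∫ t in (0 : ℝ)..1, ν j * (eGradNormSq (Φ ω t)).toReal) μ ∧
        ε ≤ ∫ ω, (∫ t in (0 : ℝ)..1, ν j * (eGradNormSq (Φ ω t)).toReal) ∂μ) :
    Literature.Turb.ZerothLaw := by
  have hw : ∀ j, ∃ u : ℝ → UnitAddTorus (Fin 3) → EuclideanSpace ℝ (Fin 3),
      Torus.IsGlobalLerayHopf (ν j) (fun _ => f) (u 0) u ∧ meanEnergy u ≤ E ∧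
        ε ≤ meanDissipation (ν j) u := by
    intro j
    obtain ⟨Ω, _, μ, _, S, Φ, hS, hLH, hshift, hEint, hEle, hDint, hDge⟩ := hens j
    obtain ⟨ω, hω1, hω2⟩ :=
      exists_witnessPath_of_stationaryEnsemble hS (hν j).le hLH hshift hEint hEle hDint hDge
    exact ⟨Φ ω, hLH ω, hω1, hω2⟩
  choose u hu using hw
  exact ⟨f, hf, hfdiv, hf0, ν, fun j => u j 0, u, hν, hν0, fun j => (hu j).1,
    ⟨E, fun j => (hu j).2.1⟩, ε, hε, fun j => (hu j).2.2⟩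

/-- **Door: `ZerothLaw` from ergodic ensembles.** As `zerothLaw_of_stationaryLHEnsembles` with
ERGODIC ensembles and the energy bound only IN THE MEAN (`∫(∫₀¹‖u‖₂²)dμ ≤ E`): almost every path of
each ensemble is then a witness (`ae_witnessPath_of_ergodicEnsemble`), and a probability measure
charges
some point. [folklore] -/
theorem zerothLaw_of_ergodicLHEnsembles {f : UnitAddTorus (Fin 3) → EuclideanSpace ℝ (Fin 3)}
    (hf : IsSmooth f) (hfdiv : IsDivFree f) (hf0 : HasZeroMean f) {ν : ℕ → ℝ} (hν : ∀ j, 0 < ν j)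
    (hν0 : Tendsto ν atTop (𝓝 0)) {E ε : ℝ} (hε : 0 < ε)
    (hens : ∀ j, ∃ (Ω : Type) (_ : MeasurableSpace Ω) (μ : Measure Ω) (_ : IsProbabilityMeasure μ)
      (S : Ω → Ω) (Φ : Ω → ℝ → UnitAddTorus (Fin 3) → EuclideanSpace ℝ (Fin 3)),
      Ergodic S μ ∧ (∀ ω, Torus.IsGlobalLerayHopf (ν j) (fun _ => f) (Φ ω 0) (Φ ω)) ∧
        (∀ ω t, Φ (S ω) t = Φ ω (t + 1)) ∧
        Integrable (fun ω => ∫ t in (0 : ℝ)..1, ∫ x, ‖Φ ω t x‖ ^ 2) μ ∧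
        (∫ ω, (∫ t in (0 : ℝ)..1, ∫ x, ‖Φ ω t x‖ ^ 2) ∂μ ≤ E) ∧
        Integrable (fun ω => ∫ t in (0 : ℝ)..1, ν j * (eGradNormSq (Φ ω t)).toReal) μ ∧
        ε ≤ ∫ ω, (∫ t in (0 : ℝ)..1, ν j * (eGradNormSq (Φ ω t)).toReal) ∂μ) :
    Literature.Turb.ZerothLaw := by
  have hw : ∀ j, ∃ u : ℝ → UnitAddTorus (Fin 3) → EuclideanSpace ℝ (Fin 3),
      Torus.IsGlobalLerayHopf (ν j) (fun _ => f) (u 0) u ∧ meanEnergy u ≤ E ∧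
        ε ≤ meanDissipation (ν j) u := by
    intro j
    obtain ⟨Ω, _, μ, _, S, Φ, hS, hLH, hshift, hEint, hEle, hDint, hDge⟩ := hens j
    obtain ⟨ω, hω1, hω2⟩ :=
      (ae_witnessPath_of_ergodicEnsemble hS (hν j).le hLH hshift hEint hEle hDint hDge).exists
    exact ⟨Φ ω, hLH ω, hω1, hω2⟩
  choose u hu using hw
  exact ⟨f, hf, hfdiv, hf0, ν, fun j => u j 0, u, hν, hν0, fun j => (hu j).1,
    ⟨E, fun j => (hu j).2.1⟩, ε, hε, fun j => (hu j).2.2⟩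

end Summit.AnomalousDissipation.AnomalousDissipation.Theorems

end
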